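import Summits.ABC.StewartYu.PrincipalUnitLatticeArith
import Literature.NumberTheory.DiophantineGeometry.PadicLogFormsKummerFree
import Literature.NumberTheory.DiophantineGeometry.MultiplicativeGroupApproximationProofs
import HarnessLib

/-!
# The signed principal-unit lattice: independence, Kummer condition, heights

Cell topic `Summits/ABC/StewartYu` (cell abc-stewartyu, HOME `run/shared/lean/pub/abc-stewartyu/`, seat p1); namespace
`Summit.ABC.StewartYu.PrincipalLattice` (continuation of
`Summits/ABC/StewartYu/PrincipalUnitLattice.lean`; theorems only).

Let `p` be a prime, `q₁, …, q_m` DISTINCT primes `≠ p`, `Λ^± ≤ ℤ^m` the signed principal-unit lattice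
and `α̃(z) = χ(z) ∏ qᵢ^{zᵢ}` the sign-normalised generator of `z ∈ Λ^±`. This file proves:

(valuations and the bridge `ord_p(α̃(z) − 1) ≥ 1` are in `PrincipalUnitLatticeArith.lean`)

* for a `ℤ`-BASIS `b` of `Λ^±` and the generators `αⱼ = α̃(bⱼ)`: the product formula
  `∏ αⱼ^{cⱼ} = (∏ χ(bⱼ)^{|cⱼ|}) · ∏ qᵢ^{(∑ cⱼbⱼ)ᵢ}` (`prod_signedProd_zpow`), multiplicative independence
  (`signedProd_basis_independent`), the **Kummer condition for free** — no non-empty sub-product of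
  the `αⱼ` is a square in `ℚ` (`not_isSquare_prod_signedProd_basis`, DERIVED from p2's `PadicKummer.not_isSquare_prod_gen_basis_zmod` via `latPMSub_eq_pmLattice`/`signedProd_eq_gen`: a square sub-product
  `∏_{j∈T} αⱼ = r²` has exponent vector `∑_{j∈T} bⱼ = 2u` with `(∏ q̄ᵢ^{uᵢ})² = 1`, so `u ∈ Λ^±` and the
  indicator of `T` would be `≡ 0 (mod 2)` in basis coordinates) —, and the main identity
  `∏ qᵢ^{eᵢ} = ∏ αⱼ^{e'ⱼ}` for `e ∈ ker ψ` with basis coordinates `e'`, the sign being `+1` because it is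
  `≡ ψ(e) = 1 (mod p)` and `p ≠ 2` (`prod_signedProd_zpow_repr`);
* heights: `h(α̃(z)) ≤ ∑ |zᵢ| log qᵢ` (`logHeight₁_signedProd_le`) and the floor `log p ≤ 2 h(α)` for any
  `α ∈ ℚ` with `ord_p(α − 1) ≥ 1`, `p` odd (`log_le_two_mul_logHeight₁`, via the tree's
  `Dioph.padicValRat_mul_log_le_logHeight₁`, `Dioph.logHeight₁_one_sub_le`, `Dioph.log_two_le_logHeight₁`).

These are the algebraic steps (M1)–(M3), (M6) of work package WP-M of the kernel `p`-adic Baker bound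
(cell abc-stewartyu); the Kummer condition is exactly the hypothesis `hind` consumed by the
Cijsouw–Waldschmidt 2-descent (`Literature/NumberTheory/Transcendental/CijsouwWaldschmidt1977Steps.lean`).
All statements are elementary and [folklore].
-/

noncomputable section

open Finset
open Literature.NumberTheory.DiophantineGeometry

namespace Summit.ABC.StewartYu.PrincipalLattice

variable {m : ℕ} {p : ℕ} [hp : Fact p.Prime]

/-! ### Generators attached to a `ℤ`-basis of `Λ^±`: products, independence, Kummer condition -/

/-- `a^{∑ f} = ∏ a^{f}` for a non-zero element of a division ring. [folklore] -/
theorem zpow_finset_sum {K : Type*} [Field K] {ι : Type*} (s : Finset ι) {a : K} (ha : a ≠ 0)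
    (f : ι → ℤ) : a ^ (∑ i ∈ s, f i) = ∏ i ∈ s, a ^ f i := by
  classical
  induction s using Finset.induction_on with
  | empty => simp
  | insert i s hi ih => rw [Finset.sum_insert hi, Finset.prod_insert hi, zpow_add₀ ha, ih]

/-- A product of signs `±1` is a sign. [folklore] -/
theorem prod_sign_eq_or {ι : Type*} (s : Finset ι) (f : ι → ℤ)
    (hf : ∀ j ∈ s, f j = 1 ∨ f j = -1) : ∏ j ∈ s, f j = 1 ∨ ∏ j ∈ s, f j = -1 := by
  classical
  induction s using Finset.induction_on with
  | empty => simp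
  | insert a s ha ih =>
    rw [Finset.prod_insert ha]
    rcases hf a (Finset.mem_insert_self a s) with h | h <;>
      rcases ih (fun j hj => hf j (Finset.mem_insert_of_mem hj)) with h' | h' <;>
      rw [h, h'] <;> norm_num

section BasisLemmas

variable (q : Fin m → ℕ) (hq0 : ∀ i, ((q i : ℕ) : ZMod p) ≠ 0)
  (b : Module.Basis (Fin m) ℤ (latPMSub q hq0))

/-- **Products of the generators.** For a `ℤ`-basis `b` of `Λ^±` and `c ∈ ℤ^m`:
`∏ⱼ α̃(bⱼ)^{cⱼ} = S · ∏ᵢ qᵢ^{(∑ⱼ cⱼ bⱼ)ᵢ}` with the sign `S = ∏ⱼ χ(bⱼ)^{|cⱼ|}`. [folklore] -/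
theorem prod_signedProd_zpow (hq : ∀ i, (q i).Prime) (c : Fin m → ℤ) :
    ∏ j, signedProd q hq0 (b j : Fin m → ℤ) ^ c j =
      ((∏ j, unitSign q hq0 (b j : Fin m → ℤ) ^ (c j).natAbs : ℤ) : ℚ) *
        ∏ i, (q i : ℚ) ^ (∑ j, c j • (b j : Fin m → ℤ)) i := by
  have hq0Q : ∀ i, (q i : ℚ) ≠ 0 := fun i => by exact_mod_cast (hq i).ne_zero
  unfold signedProd
  simp_rw [mul_zpow, Finset.prod_mul_distrib]
  congr 1
  · push_cast
    refine Finset.prod_congr rfl fun j _ => ?_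
    have hs : ((unitSign q hq0 (b j : Fin m → ℤ) : ℤ) : ℚ) = 1 ∨
        ((unitSign q hq0 (b j : Fin m → ℤ) : ℤ) : ℚ) = -1 := by
      rcases unitSign_eq_or q hq0 (b j : Fin m → ℤ) with h | h <;> rw [h] <;> norm_num
    exact sign_zpow_eq_pow_natAbs hs (c j)
  · have h1 : ∀ j, (∏ i, (q i : ℚ) ^ (b j : Fin m → ℤ) i) ^ c j =
        ∏ i, (q i : ℚ) ^ (c j * (b j : Fin m → ℤ) i) := by
      intro j
      rw [← Finset.prod_zpow]
      refine Finset.prod_congr rfl fun i _ => ?_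
      rw [← zpow_mul, mul_comm]
    simp_rw [h1]
    rw [Finset.prod_comm]
    refine Finset.prod_congr rfl fun i _ => ?_
    rw [show (∑ j, c j • (b j : Fin m → ℤ)) i = ∑ j, c j * (b j : Fin m → ℤ) i by
      simp [Finset.sum_apply], zpow_finset_sum _ (hq0Q i)]

/-- **The sign of a product reduces to the exponent map**: for a `ℤ`-basis `b` of `Λ^±`,
`∏ⱼ χ(bⱼ)^{|cⱼ|} ≡ ∏ᵢ q̄ᵢ^{(∑ⱼ cⱼ bⱼ)ᵢ} (mod p)`. [folklore] -/
theorem cast_prod_unitSign_pow (c : Fin m → ℤ) :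
    ((∏ j, unitSign q hq0 (b j : Fin m → ℤ) ^ (c j).natAbs : ℤ) : ZMod p) =
      ((Additive.toMul (expHom q hq0 (∑ j, c j • (b j : Fin m → ℤ))) : (ZMod p)ˣ) : ZMod p) := by
  rw [map_sum]
  simp_rw [map_zsmul]
  rw [toMul_sum]
  simp_rw [toMul_zsmul]
  push_cast
  refine Finset.prod_congr rfl fun j _ => ?_
  rw [cast_unitSign_eq q hq0 (b j).2]
  have hs : ((Additive.toMul (expHom q hq0 (b j : Fin m → ℤ)) : (ZMod p)ˣ) : ZMod p) = 1 ∨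
      ((Additive.toMul (expHom q hq0 (b j : Fin m → ℤ)) : (ZMod p)ˣ) : ZMod p) = -1 := by
    have h := (mem_latPM_iff q hq0 _).mp (b j).2
    rw [toMul_expHom]
    rcases h with h | h <;> rw [h] <;> simp
  exact (sign_zpow_eq_pow_natAbs hs (c j)).symm

/-- The sign `∏ⱼ χ(bⱼ)^{nⱼ}` is `±1`. [folklore] -/
theorem prod_unitSign_pow_eq_or (n : Fin m → ℕ) :
    (∏ j, unitSign q hq0 (b j : Fin m → ℤ) ^ n j) = 1 ∨
      (∏ j, unitSign q hq0 (b j : Fin m → ℤ) ^ n j) = -1 :=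
  prod_sign_eq_or _ _ fun j _ => by
    rcases unitSign_eq_or q hq0 (b j : Fin m → ℤ) with h | h
    · rw [h]; simp
    · rw [h]; exact neg_one_pow_eq_or ℤ (n j)

/-- Coordinates: `↑(∑ⱼ cⱼ • bⱼ) = ∑ⱼ cⱼ • ↑bⱼ` in `ℤ^m`. [folklore] -/
theorem coe_sum_smul (c : Fin m → ℤ) :
    ((∑ j, c j • b j : latPMSub q hq0) : Fin m → ℤ) = ∑ j, c j • (b j : Fin m → ℤ) := by
  rw [Submodule.coe_sum]
  rfl

/-- **Multiplicative independence of the generators** `α̃(bⱼ)` (`b` a `ℤ`-basis of `Λ^±`,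
`qᵢ` distinct primes): `∏ α̃(bⱼ)^{μⱼ} = 1 ⇒ μ = 0`. [folklore] -/
theorem signedProd_basis_independent (hq : ∀ i, (q i).Prime) (hinj : Function.Injective q)
    (μ : Fin m → ℤ) (h : ∏ j, signedProd q hq0 (b j : Fin m → ℤ) ^ μ j = 1) : μ = 0 := by
  rw [prod_signedProd_zpow q hq0 b hq] at h
  set z : Fin m → ℤ := ∑ j, μ j • (b j : Fin m → ℤ) with hz
  -- valuations: `z = 0`
  have hz0 : z = 0 := by
    funext i
    haveI : Fact (q i).Prime := ⟨hq i⟩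
    have hv := congrArg (padicValRat (q i)) h
    have hS : ((∏ j, unitSign q hq0 (b j : Fin m → ℤ) ^ (μ j).natAbs : ℤ) : ℚ) ≠ 0 := by
      rcases prod_unitSign_pow_eq_or q hq0 b (fun j => (μ j).natAbs) with h1 | h1 <;>
        rw [h1] <;> norm_num
    rw [padicValRat.mul hS (prod_zpow_pos q hq z).ne', padicValRat_prod_zpow q hq hinj,
      padicValRat.one] at hv
    have hvS : padicValRat (q i)
        ((∏ j, unitSign q hq0 (b j : Fin m → ℤ) ^ (μ j).natAbs : ℤ) : ℚ) = 0 := by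
      rcases prod_unitSign_pow_eq_or q hq0 b (fun j => (μ j).natAbs) with h1 | h1 <;>
        rw [h1] <;> simp
    rw [hvS, zero_add] at hv
    exact_mod_cast hv
  -- linear independence of `b`
  have hsum : (∑ j, μ j • b j : latPMSub q hq0) = 0 := by
    apply Subtype.ext
    rw [coe_sum_smul, ← hz, hz0]
    rfl
  exact funext fun j => Fintype.linearIndependent_iff.mp b.linearIndependent μ hsum j

/-- **Same lattice as p2's `PadicKummer.pmLattice`** (`Literature/NumberTheory/DiophantineGeometry/
PadicLogFormsKummerFree.lean`, which encodes `Λ^±` as `{z : (∏ q̄ᵢ^{zᵢ})² = 1}` for an abstract group):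
for `G = (ℤ/p)ˣ` the two submodules coincide (`x² = 1 ↔ x = ±1` in a field). [folklore] -/
theorem latPMSub_eq_pmLattice :
    latPMSub q hq0 = Literature.NumberTheory.DiophantineGeometry.PadicKummer.pmLattice (resUnit q hq0) := by
  ext z
  rw [mem_latPMSub_iff, mem_latPM_iff,
    Literature.NumberTheory.DiophantineGeometry.PadicKummer.mem_pmLattice]
  change _ ↔ (∏ j, resUnit q hq0 j ^ z j) ^ 2 = 1
  constructor
  · rintro (h | h) <;> rw [h] <;> simp
  · intro h
    have h' : ((∏ j, resUnit q hq0 j ^ z j : (ZMod p)ˣ) : ZMod p) *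
        ((∏ j, resUnit q hq0 j ^ z j : (ZMod p)ˣ) : ZMod p) = 1 := by
      have := congrArg (fun x : (ZMod p)ˣ => (x : ZMod p)) h
      simpa [pow_two] using this
    rcases mul_self_eq_one_iff.mp h' with h1 | h1
    · left; exact Units.ext h1
    · right; exact Units.ext (by simpa using h1)

/-- **Same generators as p2's `PadicKummer.gen`**: `α̃(z) = gen q (q̄) z`. [folklore] -/
theorem signedProd_eq_gen (z : Fin m → ℤ) :
    signedProd q hq0 z =
      Literature.NumberTheory.DiophantineGeometry.PadicKummer.gen q (resUnit q hq0) z := by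
  classical
  unfold signedProd unitSign Literature.NumberTheory.DiophantineGeometry.PadicKummer.gen
    Literature.NumberTheory.DiophantineGeometry.PadicKummer.sgn
    Literature.NumberTheory.DiophantineGeometry.PadicKummer.charProd
  rw [toMul_expHom]
  congr 2
  by_cases h : ∏ j, resUnit q hq0 j ^ z j = 1 <;> simp [h]

/-- **Kummer condition for free.** For a `ℤ`-basis `b` of `Λ^±` (distinct primes `qᵢ ≠ p`),
no non-empty sub-product of the `α̃(bⱼ)` is a square in `ℚ`: if `∏_{j∈T} α̃(bⱼ) = r²` then
`∑_{j∈T} bⱼ = 2u` with `∏ qᵢ^{uᵢ} ≡ ±1 (mod p)` (its square is `≡ 1`), so `u ∈ Λ^±` and the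
indicator vector of `T` would be divisible by `2` in `ℤ^m`. DERIVED from p2's kernel proof
`PadicKummer.not_isSquare_prod_gen_basis_zmod` (cell abc-stewartyu, M3 of PADIC-CORE §2; referee flag
F-ref-4: one lemma, one proof) by transporting the basis along `latPMSub_eq_pmLattice`. [folklore] -/
theorem not_isSquare_prod_signedProd_basis (hq : ∀ i, (q i).Prime)
    (hinj : Function.Injective q) (T : Finset (Fin m)) (hT : T.Nonempty) :
    ¬ IsSquare (∏ j ∈ T, signedProd q hq0 (b j : Fin m → ℤ)) := by
  classical
  have heq := latPMSub_eq_pmLattice q hq0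
  let e : latPMSub q hq0 ≃ₗ[ℤ]
      Literature.NumberTheory.DiophantineGeometry.PadicKummer.pmLattice (resUnit q hq0) :=
    LinearEquiv.ofEq _ _ heq
  let v := b.map e
  have hv : ∀ j, ((v j : Literature.NumberTheory.DiophantineGeometry.PadicKummer.pmLattice
      (resUnit q hq0)) : Fin m → ℤ) = (b j : Fin m → ℤ) := fun j => by
    simp [v, e, Module.Basis.map_apply]
  have h := Literature.NumberTheory.DiophantineGeometry.PadicKummer.not_isSquare_prod_gen_basis_zmod
    hq hinj (resUnit q hq0) v T hT
  rw [show (∏ j ∈ T, signedProd q hq0 (b j : Fin m → ℤ)) =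
      ∏ j ∈ T, Literature.NumberTheory.DiophantineGeometry.PadicKummer.gen q (resUnit q hq0)
        (v j : Fin m → ℤ) from Finset.prod_congr rfl fun j _ => by rw [signedProd_eq_gen, hv]]
  exact h

/-- **The main identity.** If `∏ q̄ᵢ^{eᵢ} = 1` (e.g. `ord_p(∏ qᵢ^{eᵢ} − 1) ≥ 1`), `p ≠ 2`, and
`e' ∈ ℤ^m` are the coordinates of `e ∈ Λ^±` in the basis `b`, then `∏ qᵢ^{eᵢ} = ∏ⱼ α̃(bⱼ)^{e'ⱼ}`
(the sign `∏ χ(bⱼ)^{e'ⱼ} ≡ ∏ q̄ᵢ^{eᵢ} = 1 (mod p)` is `+1` as `p ≠ 2`). [folklore] -/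
theorem prod_signedProd_zpow_repr (hq : ∀ i, (q i).Prime) (hp2 : p ≠ 2) {e : Fin m → ℤ}
    (he : expHom q hq0 e = 0) (heΛ : e ∈ latPM q hq0) :
    ∏ i, (q i : ℚ) ^ e i =
      ∏ j, signedProd q hq0 (b j : Fin m → ℤ) ^ (b.equivFun ⟨e, heΛ⟩ j) := by
  set e' : Fin m → ℤ := b.equivFun ⟨e, heΛ⟩ with he'
  have hsum : ∑ j, e' j • (b j : Fin m → ℤ) = e := by
    rw [← coe_sum_smul, ← b.equivFun_symm_apply, he', LinearEquiv.symm_apply_apply]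
  rw [prod_signedProd_zpow q hq0 b hq, hsum]
  set S : ℤ := ∏ j, unitSign q hq0 (b j : Fin m → ℤ) ^ (e' j).natAbs with hS
  have hSp : ((S : ℤ) : ZMod p) = 1 := by
    rw [hS, cast_prod_unitSign_pow q hq0 b e', hsum, he, toMul_zero, Units.val_one]
  have hS1 : S = 1 := by
    rcases prod_unitSign_pow_eq_or q hq0 b (fun j => (e' j).natAbs) with h1 | h1
    · exact h1
    · exfalso
      rw [← hS] at h1
      rw [h1] at hSp
      push_cast at hSp
      -- `-1 = 1` in `ℤ/p` forces `p ∣ 2`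
      have h2 : ((2 : ℕ) : ZMod p) = 0 := by
        have : (1 : ZMod p) + 1 = 0 := by
          calc (1 : ZMod p) + 1 = -1 + 1 := by rw [hSp]
            _ = 0 := by ring
        exact_mod_cast this
      rw [ZMod.natCast_eq_zero_iff] at h2
      exact hp2 ((Nat.prime_dvd_prime_iff_eq hp.out Nat.prime_two).mp h2)
  rw [hS1]; push_cast; rw [one_mul]

end BasisLemmas

/-! ### Heights and the floor `log p ≤ 2 h(α)` -/

/-- **Heights of the generators**: `h(α̃(z)) ≤ ∑ᵢ |zᵢ| log qᵢ` (`h(±x) = h(x)`,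
`h(∏ xᵢ) ≤ ∑ h(xᵢ)`, `h(q^k) = |k| log q`). [folklore] -/
theorem logHeight₁_signedProd_le (q : Fin m → ℕ) (hq : ∀ i, (q i).Prime)
    (hq0 : ∀ i, ((q i : ℕ) : ZMod p) ≠ 0) (z : Fin m → ℤ) :
    Height.logHeight₁ (signedProd q hq0 z) ≤ ∑ i, Real.log (q i) * |(z i : ℝ)| := by
  have h1 : Height.logHeight₁ (signedProd q hq0 z) =
      Height.logHeight₁ (∏ i, (q i : ℚ) ^ z i) := by
    unfold signedProd
    rcases unitSign_eq_or q hq0 z with h | h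
    · rw [h]; push_cast; rw [one_mul]
    · rw [h]; push_cast; rw [neg_one_mul, Height.logHeight₁_neg]
  rw [h1]
  calc Height.logHeight₁ (∏ i, (q i : ℚ) ^ z i)
      ≤ ∑ i, Height.logHeight₁ ((q i : ℚ) ^ z i) := Height.logHeight₁_prod_le _ _
    _ = ∑ i, Real.log (q i) * |(z i : ℝ)| := by
        refine Finset.sum_congr rfl fun i _ => ?_
        haveI : NeZero (q i) := ⟨(hq i).ne_zero⟩
        rw [Height.logHeight₁_zpow, Rat.logHeight₁_natCast, Nat.cast_natAbs, Int.cast_abs,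
          mul_comm]

/-- **The height floor of a principal unit.** For an odd prime `p` and `α ∈ ℚ` with
`ord_p(α − 1) ≥ 1`: `log p ≤ 2 h(α)` (indeed `log p ≤ ord_p(α−1) log p ≤ h(α − 1) ≤ log 2 + h(α)`
and `h(α) ≥ log 2` as `α ≠ 0, ±1`). [folklore] -/
theorem log_le_two_mul_logHeight₁ (hp2 : p ≠ 2) {α : ℚ} (h : 1 ≤ padicValRat p (α - 1)) :
    Real.log p ≤ 2 * Height.logHeight₁ α := by
  have hp' := hp.out
  have hα1 : α - 1 ≠ 0 := by
    intro h0; rw [h0, padicValRat.zero] at h; exact absurd h (by norm_num)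
  have hα0 : α ≠ 0 := by
    rintro rfl
    rw [zero_sub, padicValRat.neg, padicValRat.one] at h
    exact absurd h (by norm_num)
  have hαm1 : α ≠ -1 := by
    rintro h0
    rw [h0, show (-1 : ℚ) - 1 = -(2 : ℕ) by norm_num, padicValRat.neg, padicValRat.of_nat] at h
    haveI : Fact (Nat.Prime 2) := ⟨Nat.prime_two⟩
    rw [padicValNat_primes hp2] at h
    exact absurd h (by norm_num)
  have hα1' : α ≠ 1 := fun h0 => hα1 (by rw [h0, sub_self])
  have h1 : (padicValRat p (α - 1) : ℝ) * Real.log p ≤ Height.logHeight₁ (α - 1) :=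
    Dioph.padicValRat_mul_log_le_logHeight₁ p hp' hα1
  have h2 : Height.logHeight₁ (α - 1) ≤ Real.log 2 + Height.logHeight₁ α := by
    rw [show α - 1 = -(1 - α) by ring, Height.logHeight₁_neg]
    exact Dioph.logHeight₁_one_sub_le α
  have h3 : Real.log 2 ≤ Height.logHeight₁ α := Dioph.log_two_le_logHeight₁ hα0 hα1' hαm1
  have hlogp : 0 ≤ Real.log p := Real.log_natCast_nonneg p
  have h4 : (1 : ℝ) ≤ padicValRat p (α - 1) := by exact_mod_cast h
  nlinarith

end Summit.ABC.StewartYu.PrincipalLattice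

end
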